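/- Copyright: the b2b-balaban cell (near-miss cell 7), T⁴-continuum fan-out, lineage t4-ne7b-p1 (node U5c COUNT
member).  Released under the licence of the surrounding project. -/
import Summits.QuantumFields.BalabanUV.T4Continuum.Support.HistoryGenealogyRealiseChain
import Literature.MathematicalPhysics.QuantumFieldTheory.Balaban1983to89.B16OverhangN

/-!
# M5-1b (G2) — A JOIN'S DOMAIN IS FACE-CONNECTED ONE STEP ON: touch-chains of touch-connected domains are
touch-connected, and `S` of a touch-connected family is face-connected (owner module of row NE7b, lineage `t4-ne7b-p1`
gen 42; re-open object (α), `SCOPE-alpha.md` v2.4.1 STATE (3)(i), ruling R-OWNER-42-2 — PRE-POSITIONING ONLY)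

Summits-side support leaf of the T⁴-continuum cell (rung (B)+1 on a FINITE torus only; NOT infinite volume, NOT the
mass gap, NOT the Clay statement; NOT a proof of the spine estimate NE7b, which is the cell's OWN estimate, NOT PRINTED
and NOT PROVED).  [folklore] finite combinatorics on `ℤᵈ` over `Balaban1983to89.B13ScaleTransfer` (`block`, `collar`,
`Linked`, `FaceConnected`, `closureIdx`, `faceConnected_collar`), `Balaban1983to89.B16MergeGeometry` (`Touch`,
`TouchStep`, `TouchConnected`, `touch_coarse`, `touchConnected_of_faceConnected`), `Balaban1983to89.B16SProfile` (`Sop`), `Balaban1983to89.B16OverhangN`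
(`faceConnected_Sop_of_touchConnected`) and the lineage's `HistoryGenealogyRealise.{unionL, ChainTouch}` (the join clause's
touch-chain of parts); nothing printed is asserted, no `def … : Prop` fact of Bałaban's is minted, no cite-tagged
hypothesis, zero `sorry`.  B16 pp. 384–386 under audit; locators only.

WHY (the restart-the-profile scheme of M5-1b, journal «PRECISION E-OWNER-42-1»).  The TOTAL-form cost domination
restarts the `S`-profile of `B16SProfile` at every event of a line with `Z :=` the line's domain ONE STEP AFTER the
event, which must be NON-EMPTY and FACE-CONNECTED for `card_Siter_le` ∕ `two_pow_mul_treeLen_closureIdx_le` ∕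
`treeLen_le_card_sub_one` and for the fattened-volume lemma (G1, `HistoryBankingFattenedVolume`).  A birth's region is
face-connected by `NewOK`; a join unites parts that only TOUCH (the `ChainTouch` of `RealisesW`'s join clause), so the
union is merely touch-connected — but one application of `S = collar^[10] ∘ closureIdx q` makes it face-connected.
The face-connectedness of `S` of a touch-connected family is ALREADY IN THE TREE (`B16OverhangN.faceConnected_Sop_of_touchConnected`,
`faceConnected_collar_of_touchConnected`, `touchConnected_closureIdx` — the b02 lineage's N-ary merger module, REUSED BY NAME); THIS
FILE adds the list side: §1 a wall chain inside the collar from a touching pair (`linked_collar_of_touch`); §2 a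
touch-chain of touch-connected domains has a touch-connected union (`touchConnected_union_of_touch`,
`touchConnected_unionL_of_chainTouch`); §3 the join corollary `faceConnected_Sop_unionL` in the currency of the
lineage's `ChainTouch`∕`unionL`; §4 sanity.

HONEST: index-model geometry; NE7b NOT proved; spine 0∕9.  HONEST DEPENDENCY (cell): continuum YM on T⁴ ⇐ BetaPertH ∧
nine spine estimates (0∕9 proved); BetaPertH ⇐ (D1) ∧ (D4) ∧ CAP+tail.  This file changes none of it.
-/

open Finset
open Literature.MathematicalPhysics.QuantumFieldTheory.Balaban1983to89
open Literature.MathematicalPhysics.QuantumFieldTheory.Balaban1983to89.B13ScaleTransfer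
open Literature.MathematicalPhysics.QuantumFieldTheory.Balaban1983to89.B16SProfile
open Literature.MathematicalPhysics.QuantumFieldTheory.Balaban1983to89.B16MergeGeometry
open Literature.MathematicalPhysics.QuantumFieldTheory.Balaban1983to89.B16OverhangN
open Summit.QuantumFields.BalabanUV.T4Continuum.HistoryGenealogyRealise

namespace Summit.QuantumFields.BalabanUV.T4Continuum.HistoryBankingJoinCover

variable {d : ℕ}

/-! ## §1 A touching pair gives a wall chain inside the collar -/

/-- Two touching cubes of `S` are chain-connected through common walls inside the collar `S̃`. [folklore] -/
theorem linked_collar_of_touch {S : Finset (Pt d)} {a b : Pt d} (ha : a ∈ S) (h : Touch a b) :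
    Linked (collar S) a b :=
  (linked_block_center (mem_block.2 fun i => ⟨by linarith [(h i).1], (h i).2⟩)).mono (block_subset_collar ha)

/-! ## §2 Touch-chains of touch-connected domains -/

/-- Touch-connectedness is monotone along inclusions for chains: a chain inside `A ⊆ C` is a chain inside `C`.
[folklore] -/
theorem reflTransGen_touchStep_mono {A C : Finset (Pt d)} (hAC : A ⊆ C) {x y : Pt d}
    (h : Relation.ReflTransGen (TouchStep A) x y) : Relation.ReflTransGen (TouchStep C) x y := by
  induction h with
  | refl => exact Relation.ReflTransGen.refl
  | @tail b c _ hbc ih => exact ih.tail ⟨hAC hbc.1, hAC hbc.2.1, hbc.2.2⟩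

/-- **THE UNION OF TWO TOUCH-CONNECTED FAMILIES OWNING A TOUCHING PAIR IS TOUCH-CONNECTED.** [folklore] -/
theorem touchConnected_union_of_touch {A B : Finset (Pt d)} (hA : TouchConnected A) (hB : TouchConnected B)
    {a c : Pt d} (ha : a ∈ A) (hc : c ∈ B) (hac : Touch a c) : TouchConnected (A ∪ B) := by
  have hAU : A ⊆ A ∪ B := Finset.subset_union_left
  have hBU : B ⊆ A ∪ B := Finset.subset_union_right
  have bridge : Relation.ReflTransGen (TouchStep (A ∪ B)) a c :=
    Relation.ReflTransGen.single ⟨hAU ha, hBU hc, hac⟩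
  -- every point is chained to `a`
  have toA : ∀ x ∈ A ∪ B, Relation.ReflTransGen (TouchStep (A ∪ B)) x a := by
    intro x hx
    rcases Finset.mem_union.1 hx with hxA | hxB
    · exact reflTransGen_touchStep_mono hAU (hA x hxA a ha)
    · have hxc := reflTransGen_touchStep_mono hBU (hB x hxB c hc)
      have hca : Relation.ReflTransGen (TouchStep (A ∪ B)) c a :=
        Relation.ReflTransGen.single ⟨hBU hc, hAU ha, hac.symm⟩
      exact hxc.trans hca
  have fromA : ∀ y ∈ A ∪ B, Relation.ReflTransGen (TouchStep (A ∪ B)) a y := by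
    intro y hy
    rcases Finset.mem_union.1 hy with hyA | hyB
    · exact reflTransGen_touchStep_mono hAU (hA a ha y hyA)
    · exact bridge.trans (reflTransGen_touchStep_mono hBU (hB c hc y hyB))
  intro x hx y hy
  exact (toA x hx).trans (fromA y hy)

/-- **A TOUCH-CHAIN OF TOUCH-CONNECTED DOMAINS HAS A TOUCH-CONNECTED UNION** (`ChainTouch` of the join clause: every
domain of the list owns a cube touching a cube of the union of the later ones). [folklore] -/
theorem touchConnected_unionL_of_chainTouch :
    ∀ (X : List (Finset (Pt d))), ChainTouch X → (∀ D ∈ X, TouchConnected D) → TouchConnected (unionL X)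
  | [], _, _ => by
      intro x hx; simp at hx
  | [A], _, hD => by
      have hA := hD A (by simp)
      simpa [unionL] using hA
  | A :: B :: L, hct, hD => by
      obtain ⟨⟨a, ha, c, hc, hac⟩, hrest⟩ := (chainTouch_cons_cons A B L).1 hct
      have htail := touchConnected_unionL_of_chainTouch (B :: L) hrest fun D hDm => hD D (List.mem_cons_of_mem A hDm)
      rw [unionL_cons]
      exact touchConnected_union_of_touch (hD A (by simp)) htail ha hc hac

/-! ## §3 The join corollary -/

/-- **ONE STEP AFTER A JOIN THE LINE'S DOMAIN IS NON-EMPTY AND FACE-CONNECTED**: for a non-empty touch-chain `X` of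
non-empty face-connected parts and `q ≥ 1`, `S_q (⋃ X)` is non-empty and face-connected — the hypotheses of the
restarted `S`-profile (`B16SProfile.card_Siter_le`, `two_pow_mul_treeLen_closureIdx_le`,
`TreeLength.treeLen_le_card_sub_one`) and of the fattened-volume lemma. [folklore] -/
theorem faceConnected_Sop_unionL {q : ℕ} (hq : 0 < q) {X : List (Finset (Pt d))} (hX : X ≠ []) (hct : ChainTouch X)
    (hparts : ∀ D ∈ X, D.Nonempty ∧ FaceConnected D) :
    (Sop q (unionL X)).Nonempty ∧ FaceConnected (Sop q (unionL X)) := by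
  refine ⟨?_, faceConnected_Sop_of_touchConnected hq
    (touchConnected_unionL_of_chainTouch X hct fun D hD => touchConnected_of_faceConnected (hparts D hD).2)⟩
  obtain ⟨A, L, rfl⟩ := List.exists_cons_of_ne_nil hX
  obtain ⟨x, hx⟩ := (hparts A (by simp)).1
  exact Sop_nonempty q ⟨x, by rw [unionL_cons]; exact Finset.mem_union_left _ hx⟩

/-- The same for a lone step: `S_q` of a non-empty face-connected domain is non-empty and face-connected
(`B16SProfile.faceConnected_Sop`, `Sop_nonempty`, by name). [folklore] -/
theorem faceConnected_Sop_lone {q : ℕ} (hq : 0 < q) {Z : Finset (Pt d)} (hZ : Z.Nonempty) (hZc : FaceConnected Z) :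
    (Sop q Z).Nonempty ∧ FaceConnected (Sop q Z) :=
  ⟨Sop_nonempty q hZ, faceConnected_Sop hq hZc⟩

/-! ## §4 Sanity -/

/-- `d = 1`: the two DIAGONALLY-FREE touching singletons `{0}`, `{2}` do NOT touch, but `{0}`, `{1}` do, and the chain
`[{0}, {1}]` has the touch-connected union `{0, 1}` — whose `S_1` is face-connected (non-vacuous instance of §3).
[folklore] -/
theorem sanity_pair : FaceConnected (Sop 1 (unionL [({fun _ => 0} : Finset (Pt 1)), {fun _ => 1}])) := by
  have hct : ChainTouch [({fun _ => 0} : Finset (Pt 1)), {fun _ => 1}] := by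
    rw [chainTouch_cons_cons]
    refine ⟨⟨(fun _ => 0), by simp, (fun _ => 1), by simp [unionL], fun μ => ⟨by simp, by simp⟩⟩, by simp⟩
  have hsing : ∀ x : Pt 1, FaceConnected ({x} : Finset (Pt 1)) := by
    intro x a ha b hb
    rw [Finset.mem_singleton] at ha hb
    subst ha; subst hb
    exact Relation.ReflTransGen.refl
  have hparts : ∀ D ∈ [({fun _ => 0} : Finset (Pt 1)), {fun _ => 1}], D.Nonempty ∧ FaceConnected D := by
    intro D hD
    simp only [List.mem_cons, List.not_mem_nil, or_false] at hD
    rcases hD with rfl | rfl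
    · exact ⟨by simp, hsing _⟩
    · exact ⟨by simp, hsing _⟩
  exact (faceConnected_Sop_unionL Nat.one_pos (by simp) hct hparts).2

end Summit.QuantumFields.BalabanUV.T4Continuum.HistoryBankingJoinCover
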